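import Summits.QuantumFields.GaugeBoot.DiagonalRPTorusGaugeInvariantTwo
import Literature.MathematicalPhysics.QuantumFieldTheory.ConstructiveQFTWave0WilsonLoopRPProofs
import HarnessLib

/-!
# Gauge invariance does NOT rescue diagonal RP on the torus in three or more dimensions
(gauge-boot, task L3(ε), complement)

HONEST FRAMING (cell `pub-gaugeboot`, page 1 of every file): the venture produces certified bounds
on lattice expectations at stated coupling, gauge group, dimension and torus size; NOT a mass gap,
NOT a continuum limit, NOT a string tension; NOT Yang–Mills-summit-bearing (barriers
`FixedCouplingUltralocality`, `PerturbativeInvisibility`). This module is a small NEGATIVE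
structural result about which positivity constraints a TORUS certificate may use; it discharges
nothing else.

`DiagonalRPTorusGaugeInvariantTwo.lean` shows that on the TWO-dimensional even torus the
closed-half diagonal reflection positivity holds for gauge-invariant observables
(`GaugeInvariantDiagonalRP ρ β i j`, `L ≥ 6`, `β ≥ 0`), although it fails for gauge-variant ones.
Here: with a THIRD direction `m ∉ {i, j}` available (`d ≥ 3`), the geometric obstruction of
`DiagonalRPTorusNegative.lean` (the swap moves the back layer `y_i - y_j ≡ L/2` by the translation
`τ = (L/2)(e_i + e_j)` instead of fixing it) has a GAUGE-INVARIANT witness: the Polyakov line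
`P_x(U) = Re tr ρ(U(x,m) U(x+e_m,m) ⋯ U(x+(L-1)e_m,m))` of direction `m` through the back-layer
site `x₀ = (L/2) e_i` minus the one through `θ x₀ = (L/2) e_j`:
`F = P_{x₀} - P_{θx₀}` is a bounded measurable gauge-invariant back-layer observable with
`F ∘ Θ = -F`, hence `⟨(ΘF)‾ F⟩_{Λ,β} = -⟨F²⟩_{Λ,β} < 0` as soon as the character of `ρ` is not
constant (`exists_gaugeInvariant_wilsonExpectation_neg`), and
**`not_gaugeInvariantDiagonalRP`**: `¬ GaugeInvariantDiagonalRP ρ β i j` on `(ℤ/L)^d` for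
every even `L ≥ 2`, EVERY real `β`, all pairwise distinct `i, j, m`. So the `d = 2` / `d ≥ 3`
dichotomy of the cell's diagonal-RP story persists in the gauge-invariant sector: the Class-A
block list (Gram, site-RP, link-RP) of the `D = 3, 4` torus certificates is not enlarged by
gauge invariance. Nothing is claimed about Wilson lines strictly inside the half
(pub-gaugeboot LOOP-SDP.md §3.4(ii)), nor about `ℤ^d` / free boxes (where diagonal RP holds,
`DiagonalRPFreeBox.lean`). All statements are proved; elementary and, as far as the cell's
searches go, not in print as theorems. Reference for the setting: V. Kazakov, Z. Zheng, arXiv:2203.11360 §3.1.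
Printed precedent (nearest-neighbour spin systems, a remark without proof): periodic boundary conditions destroy
diagonal RP — Fröhlich–Israel–Lieb–Simon, J. Stat. Phys. 22 (1980) 297, §3 (Model 3.1); M. Biskup, in LNM 1970
(2009) §5.5; the statements here are theorem-level, gauge-theoretic forms of that obstruction (tribunal t2 F-R1).
-/

open MeasureTheory Complex Finset Function
open scoped ComplexOrder ENNReal

namespace Summit.QuantumFields.GaugeBoot

open Literature.MathematicalPhysics.QuantumFieldTheory
open Literature.RepresentationTheory.CompactGroups

noncomputable section

namespace DiagRPPolyakov

/-! ## Straight lines: gauge covariance, the swap, support -/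

section Lines

variable {d L : ℕ} {G : Type*} [Group G]

/-- A closed line (`L` steps) is conjugated by a gauge transformation (the open-line covariance
`P_n(U^g, y) = g(y) P_n(U, y) g(y + n e_k)⁻¹`, by induction on `n`, at `n = L`; the open-line
statement itself is already in the tree, `RobustYangMillsRG/Negative/WildBlocking.lean`, and is
only re-derived locally here to keep the imports of this cell file light). -/
theorem lineHolonomy_closed_gaugeTransform (g : Site d L → G) (U : GaugeConfig d L G) (k : Fin d)
    (y : Site d L) :
    lineHolonomy (gaugeTransform g U) k L y = g y * lineHolonomy U k L y * (g y)⁻¹ := by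
  have hgen : ∀ (n : ℕ) (x : Site d L), lineHolonomy (gaugeTransform g U) k n x =
      g x * lineHolonomy U k n x * (g (x + Pi.single k (n : ZMod L)))⁻¹ := by
    intro n
    induction n with
    | zero => intro x; simp [lineHolonomy]
    | succ n ih =>
      intro x
      rw [lineHolonomy, lineHolonomy, ih (x.shift k), WilsonLoopRP.shift_add_single]
      simp only [gaugeTransform]
      group
  rw [hgen, ZMod.natCast_self, Pi.single_zero, add_zero]

/-- Lines in a direction `m ∉ {i, j}` are carried by the diagonal swap onto lines:
`P_n(ΘU, y) = P_n(U, θy)`. -/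
theorem lineHolonomy_configDiagSwap {i j m : Fin d} (hmi : m ≠ i) (hmj : m ≠ j)
    (U : GaugeConfig d L G) :
    ∀ (n : ℕ) (y : Site d L),
      lineHolonomy (configDiagSwap i j U) m n y = lineHolonomy U m n (siteDiagSwap i j y)
  | 0, y => by simp [lineHolonomy]
  | n + 1, y => by
    have hsm : Equiv.swap i j m = m := Equiv.swap_apply_of_ne_of_ne hmi hmj
    rw [lineHolonomy, lineHolonomy, lineHolonomy_configDiagSwap hmi hmj U n (y.shift m),
      siteDiagSwap_shift, hsm]
    simp only [configDiagSwap, edgeDiagSwap, hsm]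

/-- The trivial configuration has trivial line holonomies. -/
theorem lineHolonomy_one (k : Fin d) : ∀ (n : ℕ) (y : Site d L),
    lineHolonomy (fun _ : Edge d L => (1 : G)) k n y = 1
  | 0, y => by simp [lineHolonomy]
  | n + 1, y => by rw [lineHolonomy, lineHolonomy_one k n, one_mul]

/-- A step in direction `m ∉ {i, j}` does not change `y_i - y_j` (iterated). -/
theorem sub_add_single_of_ne {i j m : Fin d} (hmi : m ≠ i) (hmj : m ≠ j) (y : Site d L) (s : ZMod L) :
    (y + Pi.single m s : Site d L) i - (y + Pi.single m s : Site d L) j = y i - y j := by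
  simp only [Pi.add_apply, Pi.single_eq_of_ne hmi.symm, Pi.single_eq_of_ne hmj.symm, add_zero]

end Lines

/-! ## The Polyakov line observable -/

section Polyakov

variable {d L N : ℕ} {G : Type*} [Group G] (ρ : G →* Matrix (Fin N) (Fin N) ℂ)

/-- The Polyakov line of direction `m` through `x`: `Re tr ρ(U(x,m) ⋯ U(x + (L-1) e_m, m))`. -/
def polRe (m : Fin d) (U : GaugeConfig d L G) (x : Site d L) : ℝ :=
  ((ρ (lineHolonomy U m L x)).trace).re

/-- The Polyakov line is gauge invariant. -/
theorem polRe_gaugeTransform (m : Fin d) (g : Site d L → G) (U : GaugeConfig d L G)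
    (x : Site d L) : polRe ρ m (gaugeTransform g U) x = polRe ρ m U x := by
  rw [polRe, polRe, lineHolonomy_closed_gaugeTransform, CompactGroup.trace_conj_eq]

/-- The swap carries the Polyakov line through `x` onto the one through `θx`. -/
theorem polRe_configDiagSwap {i j m : Fin d} (hmi : m ≠ i) (hmj : m ≠ j) (U : GaugeConfig d L G)
    (x : Site d L) : polRe ρ m (configDiagSwap i j U) x = polRe ρ m U (siteDiagSwap i j x) := by
  rw [polRe, polRe, lineHolonomy_configDiagSwap hmi hmj]

/-- The Polyakov line reads only links `(z, m)` with `z_i - z_j = x_i - x_j`. -/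
theorem polRe_congr {i j m : Fin d} (hmi : m ≠ i) (hmj : m ≠ j) {U V : GaugeConfig d L G}
    (x : Site d L) (h : ∀ z : Site d L, z i - z j = x i - x j → U (z, m) = V (z, m)) :
    polRe ρ m U x = polRe ρ m V x := by
  rw [polRe, polRe, WilsonLoopRP.lineHolonomy_congr m L x fun s _ =>
    h _ (sub_add_single_of_ne hmi hmj x _)]

variable [TopologicalSpace G] [IsTopologicalGroup G] [CompactSpace G]

/-- `|P_x| ≤ N`. -/
theorem abs_polRe_le (hρ : Continuous ρ) (m : Fin d) (U : GaugeConfig d L G) (x : Site d L) :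
    |polRe ρ m U x| ≤ N := by
  have h := CompactGroup.abs_re_trace_le_card ρ hρ (lineHolonomy U m L x)
  rwa [Fintype.card_fin] at h

omit [CompactSpace G] in
/-- The Polyakov line is continuous in the configuration. -/
theorem continuous_polRe (hρ : Continuous ρ) (m : Fin d) (x : Site d L) :
    Continuous fun U : GaugeConfig d L G => polRe ρ m U x := by
  have hl : ∀ (n : ℕ) (y : Site d L), Continuous fun U : GaugeConfig d L G => lineHolonomy U m n y := by
    intro n
    induction n with
    | zero => intro y; simpa [lineHolonomy] using continuous_const
    | succ n ih => intro y; exact (continuous_apply _).mul (ih _)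
  exact (Complex.continuous_re.comp hρ.matrix_trace).comp (hl L x)

end Polyakov

/-! ## The gauge-invariant negative -/

section Negative

variable {d L N : ℕ} [NeZero L] {G : Type*} [Group G] [TopologicalSpace G] [IsTopologicalGroup G]
  [CompactSpace G] [MeasurableSpace G] [BorelSpace G] [SecondCountableTopology G]
  (ρ : G →* Matrix (Fin N) (Fin N) ℂ)

/-- **The gauge-invariant witness** (`d ≥ 3`: pairwise distinct `i, j, m`; `L` even, `L ≥ 2`; any
real `β`; `ρ` continuous with non-constant character): `F = P_{x₀} - P_{θx₀}`, `x₀ = (L/2) e_i`,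
the difference of the two back-layer Polyakov lines of direction `m`, is bounded, measurable,
gauge invariant, supported in the back layer, odd under the swap, and has `⟨(ΘF)‾ F⟩_{Λ,β} < 0`. -/
theorem exists_gaugeInvariant_wilsonExpectation_neg [T2Space G] (hL : Even L) (h2 : 2 ≤ L)
    (hρ : Continuous ρ) (hρN : ∃ g, ((ρ g).trace).re ≠ N) (β : ℝ) {i j m : Fin d} (hij : i ≠ j)
    (hmi : m ≠ i) (hmj : m ≠ j) :
    ∃ F : GaugeConfig d L G → ℂ, Measurable F ∧ (∃ C : ℝ, ∀ U, ‖F U‖ ≤ C) ∧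
      IsDiagonalLayerObservable i j F ∧ IsGaugeInvariant F ∧
      (∀ U, F (configDiagSwap i j U) = -F U) ∧
      wilsonExpectation ρ β (fun U => (starRingEnd ℂ) (F (configDiagSwap i j U)) * F U) < 0 := by
  classical
  obtain ⟨g₀, hg₀⟩ := hρN
  obtain ⟨r, hr⟩ := hL
  -- the back-layer value `c = L/2` and the two base points
  set c : ZMod L := ((L / 2 : ℕ) : ZMod L) with hc
  have hc_val : c.val = L / 2 := by
    rw [hc, ZMod.val_natCast]; exact Nat.mod_eq_of_lt (by omega)
  have hc_ne : c ≠ 0 := by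
    intro h; rw [h, ZMod.val_zero] at hc_val; omega
  have hc_neg : -c = c := by
    have h2 : c + c = 0 := by
      rw [hc, ← Nat.cast_add, show L / 2 + L / 2 = L by omega, ZMod.natCast_self]
    exact neg_eq_of_add_eq_zero_left h2
  set x₀ : Site d L := Pi.single i c with hx₀
  set x₁ : Site d L := siteDiagSwap i j x₀ with hx₁
  have hx₀i : x₀ i = c := by simp [hx₀]
  have hx₀j : x₀ j = 0 := by simp [hx₀, Pi.single_eq_of_ne' hij]
  have hx₁i : x₁ i = 0 := by simp [hx₁, siteDiagSwap, Equiv.swap_apply_left, hx₀j]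
  have hx₁j : x₁ j = c := by simp [hx₁, siteDiagSwap, Equiv.swap_apply_right, hx₀i]
  have hθx₁ : siteDiagSwap i j x₁ = x₀ := siteDiagSwap_siteDiagSwap i j x₀
  have hk₀ : (x₀ i - x₀ j).val = L / 2 := by rw [hx₀i, hx₀j, sub_zero, hc_val]
  have hk₁ : (x₁ i - x₁ j).val = L / 2 := by rw [hx₁i, hx₁j, zero_sub, hc_neg, hc_val]
  -- the real observable
  set h : GaugeConfig d L G → ℝ := fun U => polRe ρ m U x₀ - polRe ρ m U x₁ with hh
  have hh_cont : Continuous h := (continuous_polRe ρ hρ m x₀).sub (continuous_polRe ρ hρ m x₁)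
  have hh_meas : Measurable h := hh_cont.measurable
  have hh_bound : ∀ U, |h U| ≤ 2 * N := fun U => by
    rw [hh]
    calc |polRe ρ m U x₀ - polRe ρ m U x₁| ≤ |polRe ρ m U x₀| + |polRe ρ m U x₁| := abs_sub _ _
      _ ≤ N + N := add_le_add (abs_polRe_le ρ hρ m U x₀) (abs_polRe_le ρ hρ m U x₁)
      _ = 2 * N := by ring
  have hh_odd : ∀ U, h (configDiagSwap i j U) = -h U := fun U => by
    simp only [hh, polRe_configDiagSwap ρ hmi hmj, ← hx₁, hθx₁]
    ring
  refine ⟨fun U => (h U : ℂ), Complex.measurable_ofReal.comp hh_meas, ⟨2 * N, fun U => ?_⟩, ?_, ?_,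
    fun U => ?_, ?_⟩
  · rw [Complex.norm_real, Real.norm_eq_abs]; exact hh_bound U
  · -- supported in the back layer
    intro U V hUV
    have e0 : polRe ρ m U x₀ = polRe ρ m V x₀ :=
      polRe_congr ρ hmi hmj x₀ fun z hz => hUV (z, m) hmi hmj (by rw [hz, hk₀])
    have e1 : polRe ρ m U x₁ = polRe ρ m V x₁ :=
      polRe_congr ρ hmi hmj x₁ fun z hz => hUV (z, m) hmi hmj (by rw [hz, hk₁])
    simp only [hh, e0, e1]
  · -- gauge invariant
    intro g U
    simp only [hh, polRe_gaugeTransform]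
  · show ((h (configDiagSwap i j U) : ℝ) : ℂ) = -((h U : ℝ) : ℂ)
    rw [hh_odd]; push_cast; ring
  · -- `⟨(ΘF)‾ F⟩ = -Z⁻¹ ∫ e^{-βS} h² < 0`
    have hint : (fun U => (starRingEnd ℂ) ((h (configDiagSwap i j U) : ℝ) : ℂ) * (h U : ℂ)) =
        fun U => ((-(h U ^ 2) : ℝ) : ℂ) := by
      funext U
      rw [Complex.conj_ofReal, hh_odd]
      push_cast
      ring
    rw [hint, wilsonExpectation_ofReal_eq ρ hρ β, ← Complex.ofReal_zero, Complex.real_lt_real]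
    -- a configuration on which `h ≠ 0`: `g₀` on the link `(x₀, m)`, `1` elsewhere
    set U₁ : GaugeConfig d L G := Function.update (fun _ => (1 : G)) (x₀, m) g₀ with hU₁
    have hline₁ : lineHolonomy U₁ m L x₁ = 1 := by
      rw [← lineHolonomy_one (G := G) m L x₁]
      refine WilsonLoopRP.lineHolonomy_congr m L x₁ fun s _ => ?_
      have hne : (x₁ + Pi.single m (s : ZMod L), m) ≠ (x₀, m) := by
        intro heq
        have := congrFun (congrArg Prod.fst heq) i
        simp only [Pi.add_apply, hx₁i, hx₀i, Pi.single_eq_of_ne hmi.symm, add_zero] at this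
        exact hc_ne this.symm
      rw [hU₁, Function.update_of_ne hne]
    have hline₀ : lineHolonomy U₁ m L x₀ = g₀ := by
      have key : ∀ n : ℕ, n = L → lineHolonomy U₁ m n x₀ = g₀ := by
        intro n hn
        obtain ⟨L', rfl⟩ : ∃ L', n = L' + 1 := ⟨n - 1, by omega⟩
        have hrest : lineHolonomy U₁ m L' (x₀.shift m) = 1 := by
          rw [← lineHolonomy_one (G := G) m L' (x₀.shift m)]
          refine WilsonLoopRP.lineHolonomy_congr m L' (x₀.shift m) fun s hs => ?_
          have hne : (x₀.shift m + Pi.single m (s : ZMod L), m) ≠ (x₀, m) := by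
            intro heq
            have := congrFun (congrArg Prod.fst heq) m
            rw [WilsonLoopRP.shift_add_single] at this
            simp only [Pi.add_apply, Pi.single_eq_same, hx₀, Pi.single_eq_of_ne hmi, zero_add] at this
            have hv := congrArg ZMod.val this
            rw [ZMod.val_natCast, ZMod.val_zero, Nat.mod_eq_of_lt (by omega)] at hv
            omega
          rw [hU₁, Function.update_of_ne hne]
        rw [lineHolonomy, hrest, mul_one, hU₁, Function.update_self]
      exact key L rfl
    have hU₁h : h U₁ ≠ 0 := by
      simp only [hh, polRe, hline₀, hline₁, map_one, Matrix.trace_one, Fintype.card_fin,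
        Complex.natCast_re]
      exact sub_ne_zero.2 hg₀
    set O : Set (GaugeConfig d L G) := h ⁻¹' {0}ᶜ with hO
    have hOo : IsOpen O := isOpen_compl_singleton.preimage hh_cont
    have hOne : O.Nonempty := ⟨U₁, hU₁h⟩
    have hOh : ∀ U ∈ O, h U ≠ 0 := fun U hU => hU
    have hpos := integral_exp_mul_sq_pos (d := d) (L := L) ρ hρ β hh_meas hh_bound hOo hOne hOh
    have hrw : (fun U : GaugeConfig d L G => Real.exp (-β * wilsonAction ρ U) * -(h U ^ 2)) =
        fun U => -(Real.exp (-β * wilsonAction ρ U) * h U ^ 2) := funext fun U => by ring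
    rw [hrw, integral_neg, mul_neg]
    linarith

/-- **Gauge invariance does not rescue diagonal RP in `d ≥ 3`**: `¬ GaugeInvariantDiagonalRP` on
the even torus `(ℤ/L)^d` (`L ≥ 2`), for every real `β`, every compact metrisable `G` and every
continuous `ρ` with non-constant character, whenever a third direction `m ∉ {i, j}` exists
(contrast `DiagRPTwo.gaugeInvariantDiagonalRP_two` in `d = 2`). -/
theorem not_gaugeInvariantDiagonalRP [T2Space G] (hL : Even L) (h2 : 2 ≤ L) (hρ : Continuous ρ)
    (hρN : ∃ g, ((ρ g).trace).re ≠ N) (β : ℝ) {i j m : Fin d} (hij : i ≠ j) (hmi : m ≠ i)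
    (hmj : m ≠ j) : ¬ GaugeInvariantDiagonalRP (d := d) (L := L) ρ β i j := by
  intro hRP
  obtain ⟨F, hF, hFb, hFL, hFg, -, hneg⟩ :=
    exists_gaugeInvariant_wilsonExpectation_neg (d := d) (L := L) ρ hL h2 hρ hρN β hij hmi hmj
  exact lt_irrefl _ (lt_of_le_of_lt (hRP F hF hFb hFL.isDiagonalHalfObservable hFg) hneg)

end Negative

end DiagRPPolyakov

end

end Summit.QuantumFields.GaugeBoot
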